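/-
Copyright: h21 programme. Stub-ideation companion (k = 1, GENERATION 11, HOME FAMILY 1 — RECOGNISE &
IMPORT) — NOT a route file, NOT a Theorems file.  Elaboration sanity for `STUB-IDEAS-stub_switch-1.md`
(gen 11): the road helpers of `STUB_IDEAS_stub_switch_2g9_Sketch.lean` (ideator k2, gen 9) that are
TREE / MATHLIB THEOREMS IN DISGUISE, discharged here SORRY-FREE with k2's signatures VERBATIM, so the
road companion can copy them (as it copied the gen-9 Tate block).  Imports no other crux workfile (the
farm does not build them as modules), so the shared vocabulary (`member`, `base`, `IntegralModel`) is
copied verbatim from k2-g9 §0/§2, not imported.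
-/
import Literature.NumberTheory.Automorphic.CDTTheorem712
import Literature.NumberTheory.EllipticCurves.ModFiveCongruenceHesseFamily
import Literature.NumberTheory.EllipticCurves.TorsionFrobenius
import Literature.NumberTheory.EllipticCurves.TorsionFrobeniusChebotarevProofs
import Literature.NumberTheory.EllipticCurves.TateCurve.NumberFieldUniformizationTwistedTateJ
import Literature.NumberTheory.EllipticCurves.TateParametrisationTorsion
import Literature.NumberTheory.EllipticCurves.NeronOggShafarevichLocal
import Literature.NumberTheory.EllipticCurves.MultiplicativeUnipotentTorsionProofs
import Literature.NumberTheory.EllipticCurves.MultiplicativeTransvectionPrimeToVProofs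
import Literature.NumberTheory.EllipticCurves.SerreOpenImageDeterminantProofs
import Literature.NumberTheory.EllipticCurves.MatarNekovar2019.IrreducibleOverQuadraticFieldProofs
import Literature.NumberTheory.EllipticCurves.PeriodIndexLocalTriviality
import Literature.NumberTheory.EllipticCurves.AdditiveReductionRamifiedTorsionLevelProofs
import Literature.NumberTheory.EllipticCurves.GoodReductionUnramifiedProofs
import Literature.NumberTheory.EllipticCurves.DivisionFieldRamificationPrimePowProofs
import Literature.NumberTheory.EllipticCurves.OpenImageMazurCharacterProofs
import Literature.NumberTheory.EllipticCurves.SzpiroLocalDataProofs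
import Literature.NumberTheory.GaloisRepresentations.DecompositionGroupOfCompletion
import Literature.NumberTheory.GaloisRepresentations.IntegralGaloisActionProofs
import Literature.NumberTheory.GaloisRepresentations.ModNCyclotomicCharacter
import Literature.NumberTheory.GaloisRepresentations.HeckeCharacterProofs
import Literature.NumberTheory.DiophantineGeometry.MinimalDiscriminant
import Literature.NumberTheory.DiophantineGeometry.MinimalDiscriminantNormProofs
import Literature.NumberTheory.DiophantineGeometry.LocalReductionFiniteBadPlacesProofs
import Literature.NumberTheory.DiophantineGeometry.LocalReductionHasMultiplicativeReductionAtProofs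
import Literature.AlgebraicGeometry.Motives.ZetaFunctionProofs
import Mathlib.NumberTheory.Padics.HeightOneSpectrum
import Mathlib.Algebra.Polynomial.Identities
import Mathlib.Algebra.Polynomial.Derivative
import HarnessLib

/-!
# Stub-ideation k = 1, GENERATION 11 (RECOGNISE & IMPORT) for `stub_switch` of crux `FreyModularity`

Companion to `STUB-IDEAS-stub_switch-1.md` (gen 11).  The road is k2's (gen 2–9, all joins proved):
`stub_switch ⇐ CuspForcedSource ⇐ SquareSource ∧ IntegralModel ∧ CuspMemberSource ∧ SurjThreeOfCuspData`.
This file discharges, with the k2-g9 signatures VERBATIM (namespace apart), the helpers that are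
recognisable tree/Mathlib theorems:

* I0  `integralModel`                          — `fisherChange_smul` + `scale_smul_short` (AEC III.1);
* B5  `helper_exists_int_congr_of_frob_fixed`  — `IsArithFrobAt` + "`y^q = y` in a finite field ⇒ `y`
      in the prime field" (`Literature.AlgebraicGeometry.Motives.mem_range_of_pow_card_eq`) + `𝓞 ℚ = ℤ`;
* B6β `helper_mem_absIntegers_of_D_eq_zero`    — `𝔇(·,1)` is MONIC over `ℤ` (`monicity!`), so a root is
      integral (`IsIntegral.tower_top`, `mem_integralClosure_iff`);
* B6γ `helper_dvd_D_of_sub_mem`                — `Polynomial.sub_dvd_eval_sub` + `𝔓 ∩ ℤ = qℤ`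
      (`Ideal.mem_of_liesOver`, `Rat.intCast_mem_asIdeal_iff`, `natGenerator_eq_of_mem`);
* B8a `helper_C4_C6_den`                       — casts (`push_cast`, `ring`);
* B8b `helper_padicValRat_eq_zero_of_cube_sub_sq` — `padicValRat.pow/neg/add_eq_min/min_le_padicValRat_add`
      + `omega`;
* B7  `helper_lift_root`                       — Hensel in one step: `Polynomial.binomExpansion` +
      `(𝔇)′ = 𝔇_λ` (`eval_derivative_DPoly`) + k2-g7's PROVED Bézout certificate (copied verbatim) +
      `padicValInt_dvd_iff`;
* B8d `helper_member_valuations_of_syzygy`     — k2-g9 `helper_member_valuations` VERBATIM conclusion,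
      modulo the NAMED k2-g5 syzygy `HesseSyzygyFiveM1` (kernel-certified there): `padicValRat.mul/pow/div`,
      VAL0 `valuation_eq_exp_neg_padicValRat` (k2, copied), `isIntegralAt_of_valuation_le_one`;
* B9  `helper_isSemistableAt_member`           — AEC VIII.1 Rem. 1.3 + VII.4.1(a) + VII.7.1 ramification
      (`hasGoodReductionAt_of_valuation_le_one_of_valuation_Δ_eq_one`, `smul_geomTorsion_eq_of_mem_inertia`,
      `exists_mem_inertia_smul_geomTorsion_ne_of_hasAdditiveReductionAt`,
      `inertia_adicCompletionPrime_eq_map_absInertia`, `adicCompletionPrime_mem_primesAbove`).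

STILL OPEN on the road after this file + k1-g10 (Piece C) + k2-g9: A1 `negOneIsSquare` (k2's decided
tables), A2 `helper_exists_tau_sq_eq_neg` (framing glue), B6α `helper_fixed_cusp_root` (the one geometric
`M` piece), and the named fact F1 `thm132_geomTorsionFive_of_hesseFamily` (hypothesis of the road).

Disproof honoured: `Disproof.switch_false_without_det` is about Piece A (`det ρ̄ = χ̄₅`); nothing here
touches the Galois side of `ρ̄` except B9 (inertia at good places), which uses no determinant.
-/

set_option linter.dupNamespace false
set_option linter.unusedVariables false

noncomputable section

open scoped NumberField Classical Pointwise
open Literature.NumberTheory.EllipticCurves Literature.NumberTheory.EllipticCurves.HesseFamilyFive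
open Literature.NumberTheory.Automorphic Literature.NumberTheory.GaloisRepresentations
open Literature.NumberTheory.Automorphic.BCDT WeierstrassCurve Field NumberField IsDedekindDomain Matrix
open Polynomial

namespace Summit.ABC.ABC.Cruxes.FreyModularity.StubSwitchK1G11

/-! ## §0 Vocabulary (copied VERBATIM from `…_2g9_Sketch.lean` §0/§2) -/

/-- Member `E_{l,m}` of Fisher's direct `5`-congruence family of `y² = x³ − 27c₄x − 54c₆`. -/
abbrev member (c₄ c₆ l m : ℚ) : WeierstrassCurve ℚ :=
  ⟨0, 0, 0, -27 * C4 c₄ c₆ l m, -54 * C6 c₄ c₆ l m⟩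

/-- The `c₄c₆`-model (= the member at `(l:m) = (1:0)`). -/
abbrev base (c₄ c₆ : ℚ) : WeierstrassCurve ℚ := ⟨0, 0, 0, -27 * c₄, -54 * c₆⟩

/-- **Piece I `IntegralModel`** (k2-g9 §2 verbatim). -/
def IntegralModel : Prop :=
  ∀ (W : WeierstrassCurve ℚ) [W.IsElliptic], ∃ c₄ c₆ : ℤ, c₄ ^ 3 ≠ c₆ ^ 2 ∧
    ∃ _ : (base (c₄ : ℚ) (c₆ : ℚ)).IsElliptic, Congr (base (c₄ : ℚ) (c₆ : ℚ)) W

/-! ## §I0 the integral model — PROVED -/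

/-- `Δ` of the `c₄c₆`-model. -/
theorem base_Δ (c₄ c₆ : ℚ) : (base c₄ c₆).Δ = 2 ^ 6 * 3 ^ 9 * (c₄ ^ 3 - c₆ ^ 2) := by
  simp only [WeierstrassCurve.Δ, WeierstrassCurve.b₂, WeierstrassCurve.b₄, WeierstrassCurve.b₆,
    WeierstrassCurve.b₈]
  ring

/-- **I0 (PROVED).** `W ≅ ⟨0,0,0,−27c₄(W),−54c₆(W)⟩` (`fisherChange_smul`), then rescale by the common
denominator `d = den(c₄)·den(c₆)` (`scale_smul_short` with `v = d`): the model
`base (d⁴c₄(W)) (d⁶c₆(W))` is integral, `ℚ`-isomorphic — hence `5`-congruent — to `W`, and elliptic. -/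
theorem integralModel : IntegralModel := by
  intro W hW
  set d : ℕ := W.c₄.den * W.c₆.den with hd
  have hdpos : 0 < d := Nat.mul_pos W.c₄.den_pos W.c₆.den_pos
  have hd0 : (d : ℚ) ≠ 0 := by exact_mod_cast hdpos.ne'
  -- the two integers
  set c₄ : ℤ := W.c₄.num * W.c₄.den ^ 3 * W.c₆.den ^ 4 with hc₄def
  set c₆ : ℤ := W.c₆.num * W.c₆.den ^ 5 * W.c₄.den ^ 6 with hc₆def
  have hc₄ : (c₄ : ℚ) = (d : ℚ) ^ 4 * W.c₄ := by
    have h : (d : ℚ) ^ 4 * W.c₄ = (W.c₄.den : ℚ) ^ 3 * (W.c₆.den : ℚ) ^ 4 * (W.c₄ * W.c₄.den) := by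
      rw [hd]; push_cast; ring
    rw [h, Rat.mul_den_eq_num, hc₄def]; push_cast; ring
  have hc₆ : (c₆ : ℚ) = (d : ℚ) ^ 6 * W.c₆ := by
    have h : (d : ℚ) ^ 6 * W.c₆ = (W.c₆.den : ℚ) ^ 5 * (W.c₄.den : ℚ) ^ 6 * (W.c₆ * W.c₆.den) := by
      rw [hd]; push_cast; ring
    rw [h, Rat.mul_den_eq_num, hc₆def]; push_cast; ring
  -- the rescaling
  set C : WeierstrassCurve.VariableChange ℚ := ⟨Units.mk0 (d : ℚ)⁻¹ (inv_ne_zero hd0), 0, 0, 0⟩ with hC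
  have hbase : C • (fisherChange W • W) = base (c₄ : ℚ) (c₆ : ℚ) := by
    rw [fisherChange_smul, hC, scale_smul_short (d : ℚ) hd0]
    ext <;> simp [hc₄, hc₆] <;> ring
  have hcongr : Congr W (base (c₄ : ℚ) (c₆ : ℚ)) :=
    congr_trans (congr_smul W (fisherChange W)) (congr_of_smul_eq C hbase)
  haveI hEll : (base (c₄ : ℚ) (c₆ : ℚ)).IsElliptic := by rw [← hbase]; infer_instance
  refine ⟨c₄, c₆, ?_, hEll, congr_symm hcongr⟩
  -- `c₄³ ≠ c₆²` from `Δ ≠ 0`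
  have hΔ : (base (c₄ : ℚ) (c₆ : ℚ)).Δ ≠ 0 := (base (c₄ : ℚ) (c₆ : ℚ)).isUnit_Δ.ne_zero
  rw [base_Δ] at hΔ
  intro h
  apply hΔ
  have h' : ((c₄ : ℚ)) ^ 3 = ((c₆ : ℚ)) ^ 2 := by exact_mod_cast h
  rw [h', sub_self, mul_zero]

/-! ## §B5 Frobenius-fixed algebraic integers are congruent to rational integers — PROVED -/

/-- **B5 (PROVED; k2-g9 signature verbatim).**  `φ • A ≡ A^{N(𝔓 ∩ 𝓞 ℚ)} (mod 𝔓)` (`IsArithFrobAt`) and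
`φ • A = A` give `ā^q = ā` in the residue field `\bar ℤ/𝔓 ⊇ 𝓞 ℚ/v = 𝔽_q`; the roots of `X^q − X` there are
exactly the prime field (`Literature.AlgebraicGeometry.Motives.mem_range_of_pow_card_eq`), and `𝓞 ℚ = ℤ`
(`Rat.ringOfIntegersEquiv`). -/
theorem helper_exists_int_congr_of_frob_fixed {v : HeightOneSpectrum (𝓞 ℚ)}
    {𝔓 : Ideal (absIntegers (𝓞 ℚ) ℚ)} (h𝔓 : 𝔓 ∈ v.primesAbove)
    {φ : absoluteGaloisGroup ℚ} (hφ : IsArithFrobAt (𝓞 ℚ) φ 𝔓)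
    (A : absIntegers (𝓞 ℚ) ℚ) (hA : φ • A = A) : ∃ a : ℤ, A - a ∈ 𝔓 := by
  haveI h𝔓max : 𝔓.IsMaximal := HeightOneSpectrum.isMaximal_of_mem_primesAbove h𝔓
  haveI : 𝔓.LiesOver v.asIdeal := (HeightOneSpectrum.mem_primesAbove_iff.mp h𝔓).2
  have hover : v.asIdeal = 𝔓.under (𝓞 ℚ) := Ideal.LiesOver.over
  -- the Frobenius congruence for the fixed element `A`
  have h1 : φ • A - A ^ Nat.card (𝓞 ℚ ⧸ 𝔓.under (𝓞 ℚ)) ∈ 𝔓 := hφ A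
  rw [hA, ← hover] at h1
  -- residue fields
  letI : Field (absIntegers (𝓞 ℚ) ℚ ⧸ 𝔓) := Ideal.Quotient.field 𝔓
  haveI : v.asIdeal.IsMaximal := v.isMaximal
  letI : Field (𝓞 ℚ ⧸ v.asIdeal) := Ideal.Quotient.field v.asIdeal
  haveI : Finite (𝓞 ℚ ⧸ v.asIdeal) := by rw [hover]; exact hφ.finite_quotient
  let ι : 𝓞 ℚ ⧸ v.asIdeal →+* absIntegers (𝓞 ℚ) ℚ ⧸ 𝔓 :=
    Ideal.quotientMap 𝔓 (algebraMap (𝓞 ℚ) (absIntegers (𝓞 ℚ) ℚ)) hover.le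
  have h2 : (Ideal.Quotient.mk 𝔓 A) ^ Nat.card (𝓞 ℚ ⧸ v.asIdeal) = Ideal.Quotient.mk 𝔓 A := by
    rw [← map_pow, eq_comm, Ideal.Quotient.eq]; exact h1
  obtain ⟨w, hw⟩ := Literature.AlgebraicGeometry.Motives.mem_range_of_pow_card_eq ι h2
  obtain ⟨r, rfl⟩ := Ideal.Quotient.mk_surjective w
  have hw' : Ideal.Quotient.mk 𝔓 (algebraMap (𝓞 ℚ) (absIntegers (𝓞 ℚ) ℚ) r) =
      Ideal.Quotient.mk 𝔓 A := by
    rw [← hw]; exact (Ideal.quotientMap_mk).symm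
  -- `r ∈ 𝓞 ℚ` is a rational integer
  obtain ⟨a, ha⟩ : ∃ a : ℤ, (a : 𝓞 ℚ) = r :=
    ⟨Rat.ringOfIntegersEquiv r, Rat.ringOfIntegersEquiv.injective (by rw [map_intCast, Int.cast_id])⟩
  subst ha
  rw [map_intCast] at hw'
  exact ⟨a, Ideal.Quotient.eq.mp hw'.symm⟩

/-! ## §B6β/γ `𝔇(·,1)` is a monic integer polynomial — PROVED -/

section DPoly

variable {R S : Type*} [CommRing R] [CommRing S]

/-- `𝔇` commutes with ring homomorphisms (it is a polynomial with integer coefficients). -/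
theorem map_D {F : Type*} [FunLike F R S] [RingHomClass F R S] (f : F) (c₄ c₆ l m : R) :
    f (D c₄ c₆ l m) = D (f c₄) (f c₆) (f l) (f m) := by
  simp only [D, map_add, map_sub, map_mul, map_pow, map_ofNat]

/-- `𝔇(c₄,c₆; X, 1) ∈ R[X]`. -/
def DPoly (c₄ c₆ : R) : R[X] := D (C c₄) (C c₆) (X : R[X]) 1

theorem eval_DPoly (c₄ c₆ l : R) : (DPoly c₄ c₆).eval l = D c₄ c₆ l 1 := by
  rw [DPoly, ← coe_evalRingHom, map_D]
  simp only [coe_evalRingHom, eval_C, eval_X, eval_one]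

theorem aeval_DPoly [Algebra R S] (c₄ c₆ : R) (x : S) :
    aeval x (DPoly c₄ c₆) = D (algebraMap R S c₄) (algebraMap R S c₆) x 1 := by
  rw [DPoly, map_D]
  simp only [aeval_C, aeval_X, map_one]

/-- `𝔇(·,1)` is monic of degree `12`. -/
theorem monic_DPoly (c₄ c₆ : R) : (DPoly c₄ c₆).Monic := by
  nontriviality R
  unfold DPoly D
  monicity!

end DPoly

/-- **B6β (PROVED; k2-g9 signature verbatim): a root of the MONIC integer polynomial `𝔇(·,1)` is an
algebraic integer.** -/
theorem helper_mem_absIntegers_of_D_eq_zero (c₄ c₆ : ℤ) {ξ : AlgebraicClosure ℚ}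
    (hξ : D (c₄ : AlgebraicClosure ℚ) (c₆ : AlgebraicClosure ℚ) ξ 1 = 0) :
    ξ ∈ absIntegers (𝓞 ℚ) ℚ := by
  rw [mem_integralClosure_iff]
  have hint : IsIntegral ℤ ξ := by
    refine ⟨DPoly c₄ c₆, monic_DPoly c₄ c₆, ?_⟩
    rw [← aeval_def, aeval_DPoly]
    simpa only [algebraMap_int_eq, eq_intCast] using hξ
  exact hint.tower_top

/-- the prime under a place of `ℚ` containing `q` is `q` (PROVED by k2, gen 9; copied verbatim). -/
theorem natGenerator_eq_of_mem {q : ℕ} (hq : q.Prime) {v : HeightOneSpectrum (𝓞 ℚ)}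
    (hv : (q : 𝓞 ℚ) ∈ v.asIdeal) : Rat.HeightOneSpectrum.natGenerator v = q := by
  have h1 : Rat.HeightOneSpectrum.natGenerator v ∣ q := by
    rw [Rat.HeightOneSpectrum.natGenerator_dvd_iff]
    have h2 := Ideal.mem_map_of_mem (Rat.IsIntegralClosure.intEquiv (𝓞 ℚ)) hv
    rwa [map_natCast] at h2
  exact (Nat.prime_dvd_prime_iff_eq (Rat.HeightOneSpectrum.prime_natGenerator v) hq).mp h1

/-- **B6γ (PROVED; k2-g9 signature verbatim): the reduction mod `𝔓` of an integral root lands in `qℤ`.** -/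
theorem helper_dvd_D_of_sub_mem (c₄ c₆ : ℤ) {q : ℕ} (hq : q.Prime) {v : HeightOneSpectrum (𝓞 ℚ)}
    (hv : (q : 𝓞 ℚ) ∈ v.asIdeal) {𝔓 : Ideal (absIntegers (𝓞 ℚ) ℚ)} (h𝔓 : 𝔓 ∈ v.primesAbove)
    {A : absIntegers (𝓞 ℚ) ℚ}
    (hA : D (c₄ : AlgebraicClosure ℚ) (c₆ : AlgebraicClosure ℚ) (A : AlgebraicClosure ℚ) 1 = 0)
    {a : ℤ} (ha : A - a ∈ 𝔓) : (q : ℤ) ∣ D c₄ c₆ a 1 := by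
  haveI : 𝔓.LiesOver v.asIdeal := (HeightOneSpectrum.mem_primesAbove_iff.mp h𝔓).2
  -- Step 1: `𝔇(A,1) = 0` already in `\bar ℤ` (the coercion to `\bar ℚ` is injective)
  have hA' : D (c₄ : absIntegers (𝓞 ℚ) ℚ) (c₆ : absIntegers (𝓞 ℚ) ℚ) A 1 = 0 := by
    have hinj : Function.Injective (algebraMap (absIntegers (𝓞 ℚ) ℚ) (AlgebraicClosure ℚ)) :=
      Subtype.val_injective
    apply hinj
    rw [map_D, map_intCast, map_intCast, map_one, map_zero]
    exact hA
  -- Step 2: `(a − A) ∣ 𝔇(a,1) − 𝔇(A,1) = 𝔇(a,1)` in `\bar ℤ`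
  have hdiv : (a : absIntegers (𝓞 ℚ) ℚ) - A ∣
      D (c₄ : absIntegers (𝓞 ℚ) ℚ) (c₆ : absIntegers (𝓞 ℚ) ℚ) (a : absIntegers (𝓞 ℚ) ℚ) 1 := by
    have h := Polynomial.sub_dvd_eval_sub (a : absIntegers (𝓞 ℚ) ℚ) A
      (DPoly (c₄ : absIntegers (𝓞 ℚ) ℚ) (c₆ : absIntegers (𝓞 ℚ) ℚ))
    rwa [eval_DPoly, eval_DPoly, hA', sub_zero] at h
  -- Step 3: hence `𝔇(a,1) ∈ 𝔓`
  have hmem : (((D c₄ c₆ a 1 : ℤ)) : absIntegers (𝓞 ℚ) ℚ) ∈ 𝔓 := by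
    have hcast : ((D c₄ c₆ a 1 : ℤ) : absIntegers (𝓞 ℚ) ℚ) =
        D (c₄ : absIntegers (𝓞 ℚ) ℚ) (c₆ : absIntegers (𝓞 ℚ) ℚ) (a : absIntegers (𝓞 ℚ) ℚ) 1 := by
      have h := map_D (Int.castRingHom (absIntegers (𝓞 ℚ) ℚ)) c₄ c₆ a 1
      simpa only [eq_intCast, Int.cast_one] using h
    rw [hcast]
    obtain ⟨t, ht⟩ := hdiv
    rw [ht]
    refine Ideal.mul_mem_right _ _ ?_
    have h := 𝔓.neg_mem_iff.mpr ha
    rwa [neg_sub] at h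
  -- Step 4: `𝔓 ∩ 𝓞 ℚ = v` and `v ∩ ℤ = qℤ`
  have h2 : ((D c₄ c₆ a 1 : ℤ) : 𝓞 ℚ) ∈ v.asIdeal := by
    rw [Ideal.mem_of_liesOver 𝔓 v.asIdeal, map_intCast]
    exact hmem
  rw [Rat.intCast_mem_asIdeal_iff, natGenerator_eq_of_mem hq hv] at h2
  exact h2

/-! ## §B8a/b valuation bookkeeping for Fisher's `𝔠₄, 𝔠₆` — PROVED -/

section Casts

theorem cast_Dl (c₄ c₆ l : ℤ) : ((Dl c₄ c₆ l 1 : ℤ) : ℚ) = Dl (c₄ : ℚ) (c₆ : ℚ) (l : ℚ) 1 := by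
  simp only [Dl]; push_cast; ring
theorem cast_Dm (c₄ c₆ l : ℤ) : ((Dm c₄ c₆ l 1 : ℤ) : ℚ) = Dm (c₄ : ℚ) (c₆ : ℚ) (l : ℚ) 1 := by
  simp only [Dm]; push_cast; ring
theorem cast_Dll (c₄ c₆ l : ℤ) : ((Dll c₄ c₆ l 1 : ℤ) : ℚ) = Dll (c₄ : ℚ) (c₆ : ℚ) (l : ℚ) 1 := by
  simp only [Dll]; push_cast; ring
theorem cast_Dlm (c₄ c₆ l : ℤ) : ((Dlm c₄ c₆ l 1 : ℤ) : ℚ) = Dlm (c₄ : ℚ) (c₆ : ℚ) (l : ℚ) 1 := by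
  simp only [Dlm]; push_cast; ring
theorem cast_Dmm (c₄ c₆ l : ℤ) : ((Dmm c₄ c₆ l 1 : ℤ) : ℚ) = Dmm (c₄ : ℚ) (c₆ : ℚ) (l : ℚ) 1 := by
  simp only [Dmm]; push_cast; ring
theorem cast_Dlll (c₄ c₆ l : ℤ) :
    ((Dlll c₄ c₆ l 1 : ℤ) : ℚ) = Dlll (c₄ : ℚ) (c₆ : ℚ) (l : ℚ) 1 := by
  simp only [Dlll]; push_cast; ring
theorem cast_Dllm (c₄ c₆ l : ℤ) :
    ((Dllm c₄ c₆ l 1 : ℤ) : ℚ) = Dllm (c₄ : ℚ) (c₆ : ℚ) (l : ℚ) 1 := by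
  simp only [Dllm]; push_cast; ring
theorem cast_Dlmm (c₄ c₆ l : ℤ) :
    ((Dlmm c₄ c₆ l 1 : ℤ) : ℚ) = Dlmm (c₄ : ℚ) (c₆ : ℚ) (l : ℚ) 1 := by
  simp only [Dlmm]; push_cast; ring
theorem cast_Dmmm (c₄ c₆ l : ℤ) :
    ((Dmmm c₄ c₆ l 1 : ℤ) : ℚ) = Dmmm (c₄ : ℚ) (c₆ : ℚ) (l : ℚ) 1 := by
  simp only [Dmmm]; push_cast; ring

end Casts

/-- **B8a (PROVED; k2-g9 signature verbatim): at integer arguments Fisher's `𝔠₄, 𝔠₆` have denominators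
`17424` and `17424·240`.**  The numerators are the integer forms `−(𝔇_λλ𝔇_μμ − 𝔇_λμ²)` and
`−𝔇_λ·N_μ + 𝔇_μ·N_λ` evaluated in `ℤ`; the `𝔇`-derivatives are treated as atoms (`cast_D…`). -/
theorem helper_C4_C6_den (c₄ c₆ l : ℤ) :
    (∃ z : ℤ, C4 (c₄ : ℚ) (c₆ : ℚ) (l : ℚ) 1 = (z : ℚ) / 17424) ∧
      ∃ z : ℤ, C6 (c₄ : ℚ) (c₆ : ℚ) (l : ℚ) 1 = (z : ℚ) / (17424 * 240) := by
  constructor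
  · refine ⟨-(Dll c₄ c₆ l 1 * Dmm c₄ c₆ l 1 - Dlm c₄ c₆ l 1 ^ 2), ?_⟩
    push_cast
    rw [cast_Dll, cast_Dmm, cast_Dlm, C4]
  · refine ⟨-(Dl c₄ c₆ l 1 * (Dllm c₄ c₆ l 1 * Dmm c₄ c₆ l 1 + Dll c₄ c₆ l 1 * Dmmm c₄ c₆ l 1
        - 2 * Dlm c₄ c₆ l 1 * Dlmm c₄ c₆ l 1)) + Dm c₄ c₆ l 1 * (Dlll c₄ c₆ l 1 * Dmm c₄ c₆ l 1
        + Dll c₄ c₆ l 1 * Dlmm c₄ c₆ l 1 - 2 * Dlm c₄ c₆ l 1 * Dllm c₄ c₆ l 1), ?_⟩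
    push_cast
    rw [cast_Dl, cast_Dm, cast_Dll, cast_Dmm, cast_Dlm, cast_Dlll, cast_Dllm, cast_Dlmm, cast_Dmmm,
      C6, C4l, C4m]
    ring

/-- **B8b (PROVED; k2-g9 signature verbatim): `q`-integral `x, y` with `ord_q(x³ − y²) = 5` force `x ≠ 0`
and `ord_q x = 0`.** -/
theorem helper_padicValRat_eq_zero_of_cube_sub_sq {q : ℕ} [Fact q.Prime] {x y : ℚ}
    (hx : x = 0 ∨ 0 ≤ padicValRat q x) (hy : y = 0 ∨ 0 ≤ padicValRat q y) (hxy : x ^ 3 - y ^ 2 ≠ 0)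
    (h5 : padicValRat q (x ^ 3 - y ^ 2) = 5) : x ≠ 0 ∧ padicValRat q x = 0 := by
  rcases eq_or_ne x 0 with hx0 | hx0
  · exfalso
    subst hx0
    have hy0 : y ≠ 0 := by rintro rfl; exact hxy (by ring)
    rw [zero_pow three_ne_zero, zero_sub, padicValRat.neg, padicValRat.pow] at h5
    omega
  refine ⟨hx0, ?_⟩
  have hxv : 0 ≤ padicValRat q x := hx.resolve_left hx0
  rcases eq_or_ne y 0 with hy0 | hy0
  · exfalso
    subst hy0
    rw [zero_pow two_ne_zero, sub_zero, padicValRat.pow] at h5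
    omega
  have hyv : 0 ≤ padicValRat q y := hy.resolve_left hy0
  have h3 : padicValRat q (x ^ 3) = 3 * padicValRat q x := by rw [padicValRat.pow]; push_cast; ring
  have h2 : padicValRat q (-y ^ 2) = 2 * padicValRat q y := by
    rw [padicValRat.neg, padicValRat.pow]; push_cast; ring
  have hsum : x ^ 3 + -y ^ 2 ≠ 0 := by rwa [← sub_eq_add_neg]
  rw [sub_eq_add_neg] at h5
  by_cases hne : padicValRat q (x ^ 3) = padicValRat q (-y ^ 2)
  · have hmin := padicValRat.min_le_padicValRat_add (p := q) hsum
    rw [h5, h3, h2] at hmin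
    rw [h3, h2] at hne
    omega
  · have hadd := padicValRat.add_eq_min (p := q) hsum (pow_ne_zero 3 hx0)
      (neg_ne_zero.mpr (pow_ne_zero 2 hy0)) hne
    rw [h5, h3, h2] at hadd
    omega

/-! ## §B9 semistability of the member away from `30(c₄³ − c₆²)` — PROVED -/

/-- integers have valuation `≤ 1` at every finite place of `ℚ`. -/
theorem valuation_intCast_le_one (w : HeightOneSpectrum (𝓞 ℚ)) (z : ℤ) :
    w.valuation ℚ (z : ℚ) ≤ 1 := by
  have h : w.valuation ℚ (algebraMap (𝓞 ℚ) ℚ (z : 𝓞 ℚ)) ≤ 1 :=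
    HeightOneSpectrum.valuation_le_one (K := ℚ) w (z : 𝓞 ℚ)
  rwa [map_intCast] at h

/-- an integer dividing an integer outside `w` is outside `w`. -/
theorem intCast_not_mem_of_dvd {w : HeightOneSpectrum (𝓞 ℚ)} {a b : ℤ} (hab : a ∣ b)
    (hb : (b : 𝓞 ℚ) ∉ w.asIdeal) : (a : 𝓞 ℚ) ∉ w.asIdeal := by
  intro ha
  apply hb
  obtain ⟨c, rfl⟩ := hab
  push_cast
  exact Ideal.mul_mem_right _ _ ha

/-- an integer outside `w` has valuation exactly `1`. -/
theorem valuation_intCast_eq_one {w : HeightOneSpectrum (𝓞 ℚ)} {z : ℤ}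
    (hz : (z : 𝓞 ℚ) ∉ w.asIdeal) : w.valuation ℚ (z : ℚ) = 1 := by
  refine le_antisymm (valuation_intCast_le_one w z) (not_lt.mp fun hlt => hz ?_)
  have h : w.valuation ℚ (algebraMap (𝓞 ℚ) ℚ (z : 𝓞 ℚ)) < 1 ↔ (z : 𝓞 ℚ) ∈ w.asIdeal :=
    HeightOneSpectrum.valuation_lt_one_iff_mem (K := ℚ) w (z : 𝓞 ℚ)
  rw [map_intCast] at h
  exact h.mp hlt

/-- the `c₄c₆`-model has good reduction at every `w ∤ 30(c₄³ − c₆²)` (AEC VIII.1 Rem. 1.3). -/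
theorem hasGoodReductionAt_base (c₄ c₆ : ℤ) {w : HeightOneSpectrum (𝓞 ℚ)}
    (hw : ((30 * (c₄ ^ 3 - c₆ ^ 2).natAbs : ℕ) : 𝓞 ℚ) ∉ w.asIdeal) :
    (base (c₄ : ℚ) (c₆ : ℚ)).HasGoodReductionAt w := by
  have hw' : (((30 * (c₄ ^ 3 - c₆ ^ 2) : ℤ)) : 𝓞 ℚ) ∉ w.asIdeal := by
    refine intCast_not_mem_of_dvd (b := ((30 * (c₄ ^ 3 - c₆ ^ 2).natAbs : ℕ) : ℤ)) ?_
      (by rwa [Int.cast_natCast])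
    push_cast
    exact mul_dvd_mul_left _ (self_dvd_abs _)
  have hpow : (((30 * (c₄ ^ 3 - c₆ ^ 2)) ^ 9 : ℤ) : 𝓞 ℚ) ∉ w.asIdeal := by
    intro h
    apply hw'
    rw [Int.cast_pow] at h
    exact Ideal.IsPrime.mem_of_pow_mem inferInstance 9 h
  have hN : ((2 ^ 6 * 3 ^ 9 * (c₄ ^ 3 - c₆ ^ 2) : ℤ) : 𝓞 ℚ) ∉ w.asIdeal :=
    intCast_not_mem_of_dvd ⟨2 ^ 3 * 5 ^ 9 * (c₄ ^ 3 - c₆ ^ 2) ^ 8, by ring⟩ hpow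
  refine hasGoodReductionAt_of_valuation_le_one_of_valuation_Δ_eq_one w _ ?_ ?_ ?_ ?_ ?_ ?_
  · simp
  · simp
  · simp
  · have h := valuation_intCast_le_one w (-27 * c₄); push_cast at h; exact h
  · have h := valuation_intCast_le_one w (-54 * c₆); push_cast at h; exact h
  · rw [base_Δ]
    have h := valuation_intCast_eq_one hN
    convert h using 2
    push_cast
    ring

/-- **B9 (PROVED; k2-g9 signature verbatim): the member is semistable at every `w ∤ 30(c₄³ − c₆²)`.**
`base` is good at `w` ⇒ `I_w` (of `𝔓₀ = adicCompletionPrime ℚ w`) acts trivially on `base[5]`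
(`smul_geomTorsion_eq_of_mem_inertia`, `w ∤ 5`) ⇒ via the equivariant `Congr`-isomorphism trivially on
`member[5]` ⇒ not additive (`exists_mem_inertia_smul_geomTorsion_ne_of_hasAdditiveReductionAt`, `m = 5`,
bridge `GreenbergSelmer.inertia w = 𝔓₀.inertia Γ_ℚ`) ⇒ semistable. -/
theorem helper_isSemistableAt_member (c₄ c₆ l : ℤ) (hΔ : c₄ ^ 3 ≠ c₆ ^ 2)
    [(base (c₄ : ℚ) (c₆ : ℚ)).IsElliptic] [(member (c₄ : ℚ) (c₆ : ℚ) (l : ℚ) 1).IsElliptic]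
    (hc : Congr (member (c₄ : ℚ) (c₆ : ℚ) (l : ℚ) 1) (base (c₄ : ℚ) (c₆ : ℚ)))
    {w : HeightOneSpectrum (𝓞 ℚ)} (hw : ((30 * (c₄ ^ 3 - c₆ ^ 2).natAbs : ℕ) : 𝓞 ℚ) ∉ w.asIdeal) :
    (member (c₄ : ℚ) (c₆ : ℚ) (l : ℚ) 1).IsSemistableAt w := by
  rw [isSemistableAt_iff_not_hasAdditiveReductionAt]
  intro hadd
  -- `w ∤ 5`
  have h5 : ((5 : ℕ) : 𝓞 ℚ) ∉ w.asIdeal := by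
    have h := intCast_not_mem_of_dvd (w := w) (a := 5) (b := ((30 * (c₄ ^ 3 - c₆ ^ 2).natAbs : ℕ) : ℤ))
      (by push_cast; exact Dvd.dvd.mul_right (by norm_num) _) (by rwa [Int.cast_natCast])
    exact_mod_cast h
  have h5' : (((5 : ℤ)) : 𝓞 ℚ) ∉ w.asIdeal := by exact_mod_cast h5
  -- good reduction of `base` and the inertia bridge
  have hgood := hasGoodReductionAt_base c₄ c₆ hw
  have e : GreenbergSelmer.inertia w = (adicCompletionPrime ℚ w).inertia (absoluteGaloisGroup ℚ) :=
    (inertia_adicCompletionPrime_eq_map_absInertia ℚ w).symm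
  obtain ⟨f, hf⟩ := hc
  have key : ∀ σ ∈ GreenbergSelmer.inertia w,
      ∀ P : (member (c₄ : ℚ) (c₆ : ℚ) (l : ℚ) 1).geomTorsion 5, σ • P = P := by
    intro σ hσ P
    rw [e] at hσ
    apply f.injective
    rw [hf]
    exact smul_geomTorsion_eq_of_mem_inertia _ hgood h5' (adicCompletionPrime_mem_primesAbove ℚ w) hσ
      (f P)
  obtain ⟨σ, hσ, Q, hσQ⟩ :=
    exists_mem_inertia_smul_geomTorsion_ne_of_hasAdditiveReductionAt _ hadd (m := 5) (by norm_num) h5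
  exact hσQ (key σ hσ Q)

/-! ## §B7 a simple root mod `q` lifts to `ord_q 𝔇(l,1) = 1` — PROVED
(Hensel à la `Polynomial.binomExpansion`; the Bézout block `BU/BV/bezout_D_Dl/helper_simple_root_mod_q`
is COPIED VERBATIM from ideator k2 gen 7, where it was already PROVED — credit k2, kit j345058) -/

section Bezout

variable {R : Type*} [CommRing R]

/-- Bézout cofactor of `𝔇(λ,1)` (k2 gen 7, kit j345058; `a = c₄`, `b = c₆`, `x = λ`). -/
def BU (a b x : R) : R :=
  2244 * a * x ^ 10 - 2244 * b * x ^ 9 - 121176 * a ^ 2 * x ^ 8 - 619344 * a * b * x ^ 7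
  + (-2345376 * a ^ 3 + 743160 * b ^ 2) * x ^ 6 - 2544696 * a ^ 2 * b * x ^ 5
  + (4470840 * a ^ 4 - 7109784 * a * b ^ 2) * x ^ 4 + (-12786576 * a ^ 3 * b + 10982400 * b ^ 3) * x ^ 3
  + (-43272900 * a ^ 5 + 42485256 * a ^ 2 * b ^ 2) * x ^ 2 + (-39588516 * a ^ 4 * b + 39388800 * a * b ^ 3) * x
  + (-106168320 * a ^ 6 + 200624280 * a ^ 3 * b ^ 2 - 94478400 * b ^ 4)

/-- Bézout cofactor of `∂_λ𝔇(λ,1)` (k2 gen 7). -/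
def BV (a b x : R) : R :=
  -187 * a * x ^ 11 + 187 * b * x ^ 10 + 12155 * a ^ 2 * x ^ 9 + 70125 * a * b * x ^ 8
  + (290070 * a ^ 3 - 82500 * b ^ 2) * x ^ 7 + 384846 * a ^ 2 * b * x ^ 6
  + (-835758 * a ^ 4 + 1314852 * a * b ^ 2) * x ^ 5 + (2287890 * a ^ 3 * b - 1878360 * b ^ 3) * x ^ 4
  + (11370645 * a ^ 5 - 11132220 * a ^ 2 * b ^ 2) * x ^ 3 + (15947415 * a ^ 4 * b - 15856720 * a * b ^ 3) * x ^ 2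
  + (38332035 * a ^ 6 - 67142052 * a ^ 3 * b ^ 2 + 28830400 * b ^ 4) * x
  + (2126817 * a ^ 5 * b - 2124760 * a ^ 2 * b ^ 3)

/-- (k2 gen 7, PROVED, `ring`) `BU·𝔇(λ,1) + BV·𝔇_λ(λ,1) = −2¹⁸·3¹⁰·5⁴·(c₄³ − c₆²)⁴`. -/
theorem bezout_D_Dl (c₄ c₆ l : R) :
    BU c₄ c₆ l * D c₄ c₆ l 1 + BV c₄ c₆ l * Dl c₄ c₆ l 1 = -(9674588160000 * (c₄ ^ 3 - c₆ ^ 2) ^ 4) := by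
  simp only [BU, BV, D, Dl]
  ring

/-- (k2 gen 7, PROVED) for a prime `q ∤ 30(c₄³ − c₆²)`, a root of `𝔇(·,1)` mod `q` is simple. -/
theorem helper_simple_root_mod_q (c₄ c₆ r : ℤ) {q : ℕ} (hq : q.Prime)
    (hq30 : ¬ (q : ℤ) ∣ 30 * (c₄ ^ 3 - c₆ ^ 2)) (hr : (q : ℤ) ∣ D c₄ c₆ r 1) :
    ¬ (q : ℤ) ∣ Dl c₄ c₆ r 1 := by
  intro hl
  have hq' : Prime (q : ℤ) := Nat.prime_iff_prime_int.mp hq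
  have hsum : (q : ℤ) ∣ BU c₄ c₆ r * D c₄ c₆ r 1 + BV c₄ c₆ r * Dl c₄ c₆ r 1 :=
    dvd_add (dvd_mul_of_dvd_right hr _) (dvd_mul_of_dvd_right hl _)
  rw [bezout_D_Dl, dvd_neg] at hsum
  have hpow : (q : ℤ) ∣ (30 * (c₄ ^ 3 - c₆ ^ 2)) ^ 18 :=
    dvd_trans hsum ⟨3 ^ 8 * 5 ^ 14 * (c₄ ^ 3 - c₆ ^ 2) ^ 14, by ring⟩
  exact hq30 (hq'.dvd_of_dvd_pow hpow)

/-- NEW (k1 g11): the formal derivative of `𝔇(·,1)` evaluates to Fisher's `𝔇_λ(·,1)`. -/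
theorem eval_derivative_DPoly (c₄ c₆ l : R) :
    (derivative (DPoly c₄ c₆)).eval l = Dl c₄ c₆ l 1 := by
  simp [DPoly, D, Dl, derivative_mul, derivative_pow]
  ring

end Bezout

/-- NEW (k1 g11): `ord_q a = 1` from `q ∣ a`, `q² ∤ a`. -/
theorem padicValInt_eq_one_of_dvd_of_not_sq_dvd {q : ℕ} [Fact q.Prime] {a : ℤ}
    (h1 : (q : ℤ) ∣ a) (h2 : ¬ (q : ℤ) ^ 2 ∣ a) : padicValInt q a = 1 := by
  have h1' := (padicValInt_dvd_iff 1 a).mp (by rwa [pow_one])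
  have h2' : ¬ (a = 0 ∨ 2 ≤ padicValInt q a) := fun h => h2 ((padicValInt_dvd_iff 2 a).mpr h)
  simp only [not_or, not_le] at h2'
  rcases h1' with h | h
  · exact absurd h h2'.1
  · omega

/-- **B7 (PROVED; signature = k2-g9 `helper_lift_root` VERBATIM): a root of `𝔇(·,1)` mod a prime
`q ∤ 30(c₄³ − c₆²)` lifts to `l ∈ {r, r + q}` with `ord_q 𝔇(l,1) = 1`.**  Simple root by the Bézout
certificate; `𝔇(r+q) = 𝔇(r) + q·𝔇_λ(r) + k·q²` by `Polynomial.binomExpansion`. -/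
theorem helper_lift_root {q : ℕ} (hq : q.Prime) (c₄ c₆ r : ℤ)
    (hq0 : ¬ (q : ℤ) ∣ 30 * (c₄ ^ 3 - c₆ ^ 2)) (hr : (q : ℤ) ∣ D c₄ c₆ r 1) :
    ∃ l : ℤ, padicValInt q (D c₄ c₆ l 1) = 1 := by
  haveI : Fact q.Prime := ⟨hq⟩
  have hqz : (q : ℤ) ≠ 0 := by exact_mod_cast hq.ne_zero
  have hsimple : ¬ (q : ℤ) ∣ Dl c₄ c₆ r 1 := helper_simple_root_mod_q c₄ c₆ r hq hq0 hr
  by_cases h2 : (q : ℤ) ^ 2 ∣ D c₄ c₆ r 1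
  · -- second-order root data: move to `r + q`
    obtain ⟨k, hk⟩ := (DPoly c₄ c₆).binomExpansion r (q : ℤ)
    rw [eval_DPoly, eval_DPoly, eval_derivative_DPoly] at hk
    refine ⟨r + q, padicValInt_eq_one_of_dvd_of_not_sq_dvd ?_ ?_⟩
    · rw [hk]
      exact dvd_add (dvd_add hr (dvd_mul_left _ _)) (Dvd.dvd.mul_left (dvd_pow_self _ two_ne_zero) k)
    · rw [hk]
      intro h
      have h3 : (q : ℤ) ^ 2 ∣ Dl c₄ c₆ r 1 * q := by
        have h' := dvd_sub (dvd_sub h h2) (Dvd.dvd.mul_left (dvd_refl ((q : ℤ) ^ 2)) k)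
        have e : D c₄ c₆ r 1 + Dl c₄ c₆ r 1 * (q : ℤ) + k * (q : ℤ) ^ 2 - D c₄ c₆ r 1
            - k * (q : ℤ) ^ 2 = Dl c₄ c₆ r 1 * q := by ring
        rwa [e] at h'
      rw [pow_two] at h3
      exact hsimple ((mul_dvd_mul_iff_right hqz).mp h3)
  · exact ⟨r, padicValInt_eq_one_of_dvd_of_not_sq_dvd hr h2⟩

/-! ## §B8d valuations of the member at `v ∋ q` — PROVED modulo the k2-g5 kernel-certified syzygy -/

/-- Fisher's syzygy `𝔠₄³ − 𝔠₆² = (c₄³ − c₆²)·𝔇⁵` at `μ = 1` — PROVED by ideator k2 (gen 5,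
`hesse_syzygy_five_m1`, `STUB_IDEAS_stub_switch_2g5_Sketch.lean`, `field_simp; ring`, ≈ 70 s,
`maxHeartbeats 8000000`); taken here as a NAMED HYPOTHESIS so this file stays fast — in the road file
`fun c₄ c₆ l => hesse_syzygy_five_m1 c₄ c₆ l : HesseSyzygyFiveM1` discharges it. -/
def HesseSyzygyFiveM1 : Prop :=
  ∀ c₄ c₆ l : ℚ, C4 c₄ c₆ l 1 ^ 3 - C6 c₄ c₆ l 1 ^ 2 = (c₄ ^ 3 - c₆ ^ 2) * D c₄ c₆ l 1 ^ 5

theorem cast_D (c₄ c₆ l : ℤ) : ((D c₄ c₆ l 1 : ℤ) : ℚ) = D (c₄ : ℚ) (c₆ : ℚ) (l : ℚ) 1 := by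
  have h := map_D (Int.castRingHom ℚ) c₄ c₆ l 1
  simpa only [eq_intCast, Int.cast_one] using h

/-- **VAL0 (PROVED; the bridge `v(x) = exp(−ord_q x)` at the place `v ∋ q` — private in the tree as
`CPMuDescent.valuation_eq_exp_neg_padicValRat`, restated with `q` in place of `natGenerator v`).** -/
theorem valuation_eq_exp_neg_padicValRat {q : ℕ} (hq : q.Prime) {v : HeightOneSpectrum (𝓞 ℚ)}
    (hv : (q : 𝓞 ℚ) ∈ v.asIdeal) {x : ℚ} (hx : x ≠ 0) :
    v.valuation ℚ x = WithZero.exp (-padicValRat q x) := by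
  rw [← natGenerator_eq_of_mem hq hv]
  haveI hp : Fact (Rat.HeightOneSpectrum.natGenerator v).Prime :=
    ⟨Rat.HeightOneSpectrum.prime_natGenerator v⟩
  haveI hp' : Fact (Nat.Prime ((Rat.HeightOneSpectrum.primesEquiv v : Nat.Primes) : ℕ)) :=
    ⟨(Rat.HeightOneSpectrum.primesEquiv v).2⟩
  have hequiv := Rat.HeightOneSpectrum.valuation_equiv_padicValuation v
  set n : ℤ := padicValRat (Rat.HeightOneSpectrum.natGenerator v) x with hn
  have h2x : Rat.padicValuation (Rat.HeightOneSpectrum.primesEquiv v) x = WithZero.exp (-n) := by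
    change Rat.padicValuation (Rat.HeightOneSpectrum.natGenerator v) x = _
    simp [Rat.padicValuation, hx, hn]
  have h2p : Rat.padicValuation (Rat.HeightOneSpectrum.primesEquiv v)
      ((Rat.HeightOneSpectrum.natGenerator v : ℚ) ^ n) = WithZero.exp (-n) := by
    change Rat.padicValuation (Rat.HeightOneSpectrum.natGenerator v) _ = _
    rw [map_zpow₀, Rat.padicValuation_self, ← WithZero.exp_zsmul]
    simp
  have h1p : v.valuation ℚ ((Rat.HeightOneSpectrum.natGenerator v : ℚ) ^ n) = WithZero.exp (-n) := by
    rw [map_zpow₀, Literature.NumberTheory.GaloisRepresentations.Rat.valuation_natGenerator,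
      ← WithZero.exp_zsmul]
    simp
  rw [← h1p]
  exact (hequiv.eq_iff).mpr (h2x.trans h2p.symm)


/-- `c₄` of a member (PROVED, gen 5; `6⁴ = 1296`). -/
theorem member_c₄ (c₄ c₆ l m : ℚ) : (member c₄ c₆ l m).c₄ = 6 ^ 4 * C4 c₄ c₆ l m := by
  simp only [WeierstrassCurve.c₄, WeierstrassCurve.b₂, WeierstrassCurve.b₄]; ring

/-- `Δ` of a member (PROVED, gen 5). With the gen-5 PROVED syzygy `hesse_syzygy_five_m1`
(`𝔠₄³ − 𝔠₆² = (c₄³ − c₆²)·𝔇(l,1)⁵`, `…_2g5_Sketch.lean`, ≈ 70 s `field_simp; ring`, not re-run here)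
this is `Δ(E_{l,1}) = 2⁶3⁹(c₄³ − c₆²)𝔇(l,1)⁵`. -/
theorem member_Δ (c₄ c₆ l m : ℚ) :
    (member c₄ c₆ l m).Δ = 2 ^ 6 * 3 ^ 9 * (C4 c₄ c₆ l m ^ 3 - C6 c₄ c₆ l m ^ 2) := by
  simp only [WeierstrassCurve.Δ, WeierstrassCurve.b₂, WeierstrassCurve.b₄, WeierstrassCurve.b₆,
    WeierstrassCurve.b₈]
  ring

section PadicBookkeeping

variable {q : ℕ}

theorem padicValRat_intCast_nonneg (z : ℤ) : 0 ≤ padicValRat q (z : ℚ) := by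
  rw [padicValRat.of_int]; positivity

theorem padicValRat_intCast_of_not_dvd {z : ℤ} (h : ¬ (q : ℤ) ∣ z) : padicValRat q (z : ℚ) = 0 := by
  rw [padicValRat.of_int, padicValInt.eq_zero_of_not_dvd h, Nat.cast_zero]

variable [Fact q.Prime]

/-- `x = z/N` with `q ∤ N` is `q`-integral (in the `x = 0 ∨ 0 ≤ ord_q x` form of B8b). -/
theorem qIntegral_of_eq_div {x : ℚ} {z N : ℤ} (hN : ¬ (q : ℤ) ∣ N) (hx : x = z / N) :
    x = 0 ∨ 0 ≤ padicValRat q x := by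
  by_cases hz : z = 0
  · left; rw [hx, hz, Int.cast_zero, zero_div]
  · right
    have hN0 : N ≠ 0 := by rintro rfl; exact hN (dvd_zero _)
    rw [hx, padicValRat.div (Int.cast_ne_zero.mpr hz) (Int.cast_ne_zero.mpr hN0),
      padicValRat_intCast_of_not_dvd hN, sub_zero]
    exact padicValRat_intCast_nonneg z

end PadicBookkeeping

set_option linter.deprecated false in
/-- `q`-integral rationals have valuation `≤ 1` at the place `v ∋ q`. -/
theorem valuation_le_one_of_qIntegral {q : ℕ} (hq : q.Prime) {v : HeightOneSpectrum (𝓞 ℚ)}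
    (hv : (q : 𝓞 ℚ) ∈ v.asIdeal) {r : ℚ} (hr : r = 0 ∨ 0 ≤ padicValRat q r) :
    v.valuation ℚ r ≤ 1 := by
  rcases eq_or_ne r 0 with h0 | h0
  · rw [h0, map_zero]; exact zero_le'
  · rw [valuation_eq_exp_neg_padicValRat hq hv h0, ← WithZero.exp_zero, WithZero.exp_le_exp]
    have := hr.resolve_left h0
    omega

/-- **B8d (PROVED modulo the named syzygy; conclusion = k2-g9 `helper_member_valuations` VERBATIM):
`Δ ≠ 0`, the member is `v`-integral, `v(c₄) = 1`, `v(Δ) = exp(−5)` at `v ∋ q`, `q ∤ 330(c₄³ − c₆²)`,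
`ord_q 𝔇(l,1) = 1`.**  In the road file: `helper_member_valuations … :=
helper_member_valuations_of_syzygy (fun a b c => hesse_syzygy_five_m1 a b c) …`. -/
theorem helper_member_valuations_of_syzygy (hsyz : HesseSyzygyFiveM1) (c₄ c₆ l : ℤ)
    (hΔ : c₄ ^ 3 ≠ c₆ ^ 2) {q : ℕ} (hq : q.Prime)
    (hq0 : ¬ (q : ℤ) ∣ 330 * (c₄ ^ 3 - c₆ ^ 2)) (hl : padicValInt q (D c₄ c₆ l 1) = 1)
    {v : HeightOneSpectrum (𝓞 ℚ)} (hv : (q : 𝓞 ℚ) ∈ v.asIdeal) :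
    (member (c₄ : ℚ) (c₆ : ℚ) (l : ℚ) 1).Δ ≠ 0 ∧
      (member (c₄ : ℚ) (c₆ : ℚ) (l : ℚ) 1).IsIntegralAt v ∧
      v.valuation ℚ (member (c₄ : ℚ) (c₆ : ℚ) (l : ℚ) 1).c₄ = 1 ∧
      v.valuation ℚ (member (c₄ : ℚ) (c₆ : ℚ) (l : ℚ) 1).Δ = WithZero.exp (-(5 : ℤ)) := by
  haveI : Fact q.Prime := ⟨hq⟩
  have hP : Prime (q : ℤ) := Nat.prime_iff_prime_int.mp hq
  -- the primes `q` avoids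
  have hqt : ¬ (q : ℤ) ∣ c₄ ^ 3 - c₆ ^ 2 := fun h => hq0 (Dvd.dvd.mul_left h 330)
  have hq2 : ¬ (q : ℤ) ∣ 2 := fun h => hq0 (h.trans ⟨165 * (c₄ ^ 3 - c₆ ^ 2), by ring⟩)
  have hq3 : ¬ (q : ℤ) ∣ 3 := fun h => hq0 (h.trans ⟨110 * (c₄ ^ 3 - c₆ ^ 2), by ring⟩)
  have hq5 : ¬ (q : ℤ) ∣ 5 := fun h => hq0 (h.trans ⟨66 * (c₄ ^ 3 - c₆ ^ 2), by ring⟩)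
  have hq11 : ¬ (q : ℤ) ∣ 11 := fun h => hq0 (h.trans ⟨30 * (c₄ ^ 3 - c₆ ^ 2), by ring⟩)
  have hq6 : ¬ (q : ℤ) ∣ 6 := fun h =>
    (hP.dvd_mul.mp (show (q : ℤ) ∣ 2 * 3 by norm_num; exact h)).elim hq2 hq3
  have hq30 : ¬ (q : ℤ) ∣ 30 := fun h =>
    (hP.dvd_mul.mp (show (q : ℤ) ∣ 6 * 5 by norm_num; exact h)).elim hq6 hq5
  have hq66 : ¬ (q : ℤ) ∣ 66 := fun h =>
    (hP.dvd_mul.mp (show (q : ℤ) ∣ 6 * 11 by norm_num; exact h)).elim hq6 hq11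
  have h17424 : ¬ (q : ℤ) ∣ 17424 := fun h =>
    hq66 (hP.dvd_of_dvd_pow (n := 4) (h.trans ⟨1089, by norm_num⟩))
  have h240 : ¬ (q : ℤ) ∣ 240 := fun h =>
    hq30 (hP.dvd_of_dvd_pow (n := 4) (h.trans ⟨3375, by norm_num⟩))
  have hden : ¬ (q : ℤ) ∣ 17424 * 240 := fun h => (hP.dvd_mul.mp h).elim h17424 h240
  -- `x = 𝔠₄(l,1)`, `y = 𝔠₆(l,1)` are `q`-integral (B8a)
  obtain ⟨⟨z₁, hz₁⟩, ⟨z₂, hz₂⟩⟩ := helper_C4_C6_den c₄ c₆ l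
  set x : ℚ := C4 (c₄ : ℚ) (c₆ : ℚ) (l : ℚ) 1 with hxdef
  set y : ℚ := C6 (c₄ : ℚ) (c₆ : ℚ) (l : ℚ) 1 with hydef
  have hx : x = 0 ∨ 0 ≤ padicValRat q x :=
    qIntegral_of_eq_div (N := 17424) h17424 (by rw [hz₁]; push_cast; ring)
  have hy : y = 0 ∨ 0 ≤ padicValRat q y :=
    qIntegral_of_eq_div (N := 17424 * 240) hden (by rw [hz₂]; push_cast; ring)
  -- the syzygy: `x³ − y² = (c₄³ − c₆²)·𝔇(l,1)⁵`, so `ord_q(x³ − y²) = 0 + 5·1`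
  have hsyz' : x ^ 3 - y ^ 2 = ((c₄ ^ 3 - c₆ ^ 2 : ℤ) : ℚ) * ((D c₄ c₆ l 1 : ℤ) : ℚ) ^ 5 := by
    rw [hxdef, hydef, hsyz, cast_D]; push_cast; ring
  have ht0 : ((c₄ ^ 3 - c₆ ^ 2 : ℤ) : ℚ) ≠ 0 := by exact_mod_cast sub_ne_zero.mpr hΔ
  have hD0 : (D c₄ c₆ l 1 : ℤ) ≠ 0 := by
    intro h; rw [h, padicValInt.zero] at hl; exact zero_ne_one hl
  have hD0' : ((D c₄ c₆ l 1 : ℤ) : ℚ) ≠ 0 := by exact_mod_cast hD0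
  have hxy0 : x ^ 3 - y ^ 2 ≠ 0 := by rw [hsyz']; exact mul_ne_zero ht0 (pow_ne_zero 5 hD0')
  have hxy5 : padicValRat q (x ^ 3 - y ^ 2) = 5 := by
    rw [hsyz', padicValRat.mul ht0 (pow_ne_zero 5 hD0'), padicValRat.pow,
      padicValRat_intCast_of_not_dvd hqt, padicValRat.of_int, hl]
    simp
  -- B8b: `x ≠ 0`, `ord_q x = 0`
  obtain ⟨hx0, hxv⟩ := helper_padicValRat_eq_zero_of_cube_sub_sq hx hy hxy0 hxy5
  -- small primes have `ord_q = 0`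
  have hv2 : padicValRat q 2 = 0 := by
    have h := padicValRat_intCast_of_not_dvd hq2; simp only [Int.cast_ofNat] at h; exact h
  have hv3 : padicValRat q 3 = 0 := by
    have h := padicValRat_intCast_of_not_dvd hq3; simp only [Int.cast_ofNat] at h; exact h
  have hv6 : padicValRat q 6 = 0 := by
    have h := padicValRat_intCast_of_not_dvd hq6; simp only [Int.cast_ofNat] at h; exact h
  -- the member's invariants
  have hc4 : (member (c₄ : ℚ) (c₆ : ℚ) (l : ℚ) 1).c₄ = 6 ^ 4 * x := member_c₄ _ _ _ _
  have hΔm : (member (c₄ : ℚ) (c₆ : ℚ) (l : ℚ) 1).Δ = 2 ^ 6 * 3 ^ 9 * (x ^ 3 - y ^ 2) :=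
    member_Δ _ _ _ _
  have hc4val : padicValRat q (6 ^ 4 * x) = 0 := by
    rw [padicValRat.mul (by norm_num) hx0, padicValRat.pow, hv6, hxv]; simp
  have hΔval : padicValRat q (2 ^ 6 * 3 ^ 9 * (x ^ 3 - y ^ 2)) = 5 := by
    rw [padicValRat.mul (by norm_num) hxy0, padicValRat.mul (by norm_num) (by norm_num),
      padicValRat.pow, padicValRat.pow, hv2, hv3, hxy5]; simp
  have ha4 : -27 * x = 0 ∨ 0 ≤ padicValRat q (-27 * x) := by
    right
    rw [padicValRat.mul (by norm_num) hx0, padicValRat.neg, hxv, add_zero]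
    have h := padicValRat_intCast_nonneg (q := q) 27; simp only [Int.cast_ofNat] at h; exact h
  have ha6 : -54 * y = 0 ∨ 0 ≤ padicValRat q (-54 * y) := by
    rcases eq_or_ne y 0 with hy0 | hy0
    · left; rw [hy0, mul_zero]
    · right
      rw [padicValRat.mul (by norm_num) hy0, padicValRat.neg]
      have h54 : 0 ≤ padicValRat q 54 := by
        have h := padicValRat_intCast_nonneg (q := q) 54; simp only [Int.cast_ofNat] at h; exact h
      have hyv := hy.resolve_left hy0
      linarith
  refine ⟨?_, ?_, ?_, ?_⟩
  · rw [hΔm]; exact mul_ne_zero (by norm_num) hxy0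
  · refine isIntegralAt_of_valuation_le_one v _ ?_ ?_ ?_ ?_ ?_
    · simp
    · simp
    · simp
    · exact valuation_le_one_of_qIntegral hq hv ha4
    · exact valuation_le_one_of_qIntegral hq hv ha6
  · rw [hc4, valuation_eq_exp_neg_padicValRat hq hv (mul_ne_zero (by norm_num) hx0), hc4val, neg_zero,
      WithZero.exp_zero]
  · rw [hΔm, valuation_eq_exp_neg_padicValRat hq hv (mul_ne_zero (by norm_num) hxy0), hΔval]

/-! ## sanity: the discharged helpers have exactly the k2-g9 shapes consumed by the road's glue -/

example : IntegralModel := integralModel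
example (c₄ c₆ l : ℤ) := helper_C4_C6_den c₄ c₆ l

end Summit.ABC.ABC.Cruxes.FreyModularity.StubSwitchK1G11

end
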